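import Summits.BirchSwinnertonDyer.Rank1Residual.Supersingular.KobayashiMainConjectureX7FouquetWan
import Summits.BirchSwinnertonDyer.Rank1Residual.Supersingular.RankZeroUpperBoundProp48
import HarnessLib

/-!
# Fouquet–Wan Thm 4.51 = Thm 1.13 (the CRYSTALLINE chain of §4.6, PREPRINT) read through Kobayashi 2003
# Thm 7.4, as a second, WEAKER explicitly labelled OPEN hypothesis in the ± currency — the chain the cell
# actually audits (W-lev-9) — and the conditional class theorems it gives on the X7 Fouquet–Wan locus, where
# its extra big-image hypothesis is DISCHARGED by a tree theorem at every odd `p` (cell `bsd-ssimc`, seat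
# `bsd-ssimc-k3-c3` gen 0, order W-lev-9 part 2)

HONEST FRAMING: an UNREFEREED preprint enters the tree ONLY as an explicitly labelled OPEN hypothesis, never
as a theorem; nothing is asserted about any curve; nothing is booked. Pattern of
`BurungaleSkinnerTianWan2024_thm13_OPEN` and `FouquetWan2021_thm51_via_kobayashi74_OPEN` (this directory):
ONE `def … : Prop` (the OPEN binder) and theorems taking it as an explicit hypothesis.

Why a SECOND Fouquet–Wan binder next to `FouquetWan2021_thm51_via_kobayashi74_OPEN` (p414007). Fouquet–Wan,
arXiv:2107.13726, contains TWO routes to Kato's main conjecture (their Conj 1.5 = [Kato] Conj 12.10,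
equality of characteristic ideals) for an eigencuspform `f ∈ S_k(Γ₀(N))`, `p ∤ N`:
* **Thm 4.51 = Thm 1.13 (§4.6, "the Iwasawa Main Conjecture in the crystalline case", p. 50 L20–40):**
  hypotheses (i) `ρ_f|G_{ℚ_p}` crystalline and short, (ii) `ρ̄_f|G_{ℚ_p}` absolutely irreducible,
  (iii) `∃ ℓ ∥ N` with `dim ρ̄^{I_ℓ} = 1`, `dim ρ̄^{G_ℓ} = 0` — in their convention `ρ_f = H¹_ét`
  (`= T_pE(−1)` for an elliptic curve: sub-character the UNRAMIFIED `μ`, quotient `μχ_cyc⁻¹`, Thm 4.38 /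
  Thm 5.1 (H3)), so (iii) reads: `ρ̄` RAMIFIED at `ℓ` and `μ ≠ 1`, i.e. for `E/ℚ` a prime `ℓ ≠ p` of
  NON-SPLIT multiplicative reduction with `E[p]` ramified at `ℓ` (`p ∤ ord_ℓ Δ_min`) — verbatim the locus of
  the registered stub `stub_fwLocus`. Its PROOF is §4.6: Thm 4.41 = Thm 7.32 (the Greenberg main-conjecture
  containment over an auxiliary imaginary quadratic `K`, appendix §7, the U(3,1) Eisenstein side) ⇒ Prop
  4.42 (IMC up to powers of `p`, Beilinson–Flach classes [LLZ]/[KLZ]) ⇒ §4.6.3 (powers of `p`: the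
  one-variable unramified family through a generic arithmetic point, Prop 4.48, Lemma 4.49), and it INVOKES
  Kato's INTEGRAL divisibility (their Thm (TheoKatoIntro), p. 4 L1: "if the image of `ρ_f|G_{ℚ(ζ_{p^∞})}`
  contains a subgroup conjugated to `SL₂(ℤ_p)`"; §4.6.3 opens with "as we already know that
  `char H²_ét(ℤ[1/p], T(f)_Iw)` divides `char H¹_ét/Λ·z(f)_Iw`", p. 46) — a hypothesis the printed statement
  of 4.51 omits. Read honestly ("what the §4.6 proof supports") Thm 4.51 therefore carries Kato's (12.5.2),
  the tree predicate `Kato2004.ImageContainsSL2 W p`.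
* **Thm 5.1 (§5, p. 53):** the same conclusion WITHOUT any image hypothesis (and for non-crystalline
  points), by CONTINUITY of the main conjecture over the universal deformation space
  (`R_Σ(ρ̄) ≅ 𝕋^Σ_𝔪`, Nakamura's universal zeta morphism [NakamuraUniversal] = Invent. Math. 234 (2023),
  [FouquetDihedral]): integrality at a small-image point is imported from big-image points of the family.
  This is what `FouquetWan2021_thm51_via_kobayashi74_OPEN` transcribes.
The cell's line-by-line audit of Fouquet–Wan FOR X7 (seat `bsd-ssimc-lev` MEMO-5 + addA–addD, REPORT-lev-7
PASS; this seat's MEMO-1) is an audit of the §4.6 CHAIN — Thm 4.51 — not of §5. So the PRE claim that a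
future «verified by cell + referee» tier would attach to is the WEAKER one typed here, and the registered stub
`stub_fwLocus` of crux `KobayashiLowerHalfLargeImage` (route `SignedLowerHalves`, item
stmt-BirchSwinnertonDyer-19001) is closed MODULO it (`X7.kobayashiLowerDivisibility_of_thm451_OPEN`) with
the big-image hypothesis DISCHARGED IN THE KERNEL: on corner X7 (`p` odd, good supersingular) `surj(p)` ⟹
`Kato2004.ImageContainsSL2 W p` at EVERY odd `p` — `p ≥ 5` by Serre's lifting lemma, `p = 3` by Wuthrich
2014 Lemma 20 (a tree THEOREM: at a good supersingular `3` the `9`-torsion of the height-2 formal group is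
wildly ramified enough) — tree `ClassX7.imageContainsSL2_of_surj` (`RankZeroUpperBoundProp48.lean`). In
particular the audit flag A-KATO-3 of MEMO-5-addB ("at `p = 3` the SL₂(ℤ₃)-image needs a certificate or the
§5 route") is VOID on X7: Elkies' `3`-adic phenomenon needs an additive `3`. Here the stub's `Surj` binder is
LOAD-BEARING (it feeds Kato's (12.5.2)), as the crux's «large image» design intends; under the §5 binder it
was idle.

`thm451_OPEN_of_thm51_OPEN`: the §5 binder implies the §4.6 binder (one hypothesis dropped), so every
conditional theorem below is implied by its p414007 counterpart's hypothesis — the new statements are the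
STRONGER conditional results (weaker assumption).

Source and audit: `paper:arxiv-2107.13726` p0050 L20–40 (Thm 4.51 + proof), p0044 L22–35 (Thm 4.38), p0044
L73–p0045 L14 (Thm 4.41), p0046 (Cor 4.44, proof of Thm (TheoSansP), first sentence of §4.6.3), p0004 L1
(TheoKatoIntro), p0053 L5–13 (Thm 5.1 (H3), the `μ ≠ 1` clause); Kobayashi, Invent. Math. 152 (2003) Thm 7.4
p. 13 (`paper:doi-10-1007-s00222-002-0265-4` p0013 L25); Kato, Astérisque 295 (2004) (12.5.2) p. 222;
Wuthrich, Doc. Math. 19 (2014) Lemma 20 p. 399. FRESHNESS 2026-08-26: Fouquet–Wan is arXiv only.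

References: [FouquetWan2021] Thm 4.51 / 1.13, Thm 4.38, Thm 4.41 = 7.32, Thm 5.1; [Kobayashi2003] Thm 7.4
(p. 13), Conjecture (p. 2); [Kato2004Asterisque] (12.5.2) in Thm 12.5 (4) (p. 222); [Wuthrich2014] Lemma 20
(p. 399); [SerreAbelianLadic1968] IV-23 Lemma 3; [BurungaleKobayashiOta2023] App. A Cor. A.5; [BDKim2013]
Cor. 3.15; [Pollack2003]; [Miller2011LMS] Def 1.1.
-/

set_option autoImplicit false

noncomputable section

open scoped Classical MatrixGroups ModularForm

open CongruenceSubgroup WeierstrassCurve Literature.NumberTheory.EllipticCurves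
  Literature.NumberTheory.EllipticCurves.ModularForms
  Literature.NumberTheory.EllipticCurves.Rank1Residual
  Literature.NumberTheory.EllipticCurves.Rank1Residual.Typed
  Literature.NumberTheory.EllipticCurves.Kobayashi2003

namespace Summit.BirchSwinnertonDyer.Rank1Residual.Supersingular

/-- **OPEN HYPOTHESIS — UNREFEREED PREPRINT (Fouquet–Wan, arXiv:2107.13726, 2021), Thm 4.51 = Thm 1.13
(§4.6, the crystalline chain) WITH the SL₂(ℤ_p)-image hypothesis its proof invokes, READ THROUGH Kobayashi
2003 Thm 7.4 (published).** FW Thm 4.51 (p. 50): `f ∈ S_k(Γ₀(N))` normalised, `k ≥ 2`; (i) `ρ_f|G_{ℚ_p}`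
crystalline (`p ∤ N`) and short; (ii) `ρ̄_f|G_{ℚ_p}` absolutely irreducible; (iii) `∃ ℓ ∥ N`,
`dim ρ̄^{I_ℓ} = 1`, `dim ρ̄^{G_ℓ} = 0` ⇒ Kato's main conjecture (Conj 12.10, equality of characteristic
ideals) for `M(f)`; the proof (§4.6.3, p. 46) uses Kato's INTEGRAL divisibility, stated (Thm (TheoKatoIntro),
p. 4) under "the image of `ρ_f|G_{ℚ(ζ_{p^∞})}` contains `SL₂(ℤ_p)`". Kobayashi Thm 7.4: for `E/ℚ`, `p` odd
good with `a_p = 0`, Kato's main conjecture ⟺ each signed main conjecture. TRANSCRIBED (elliptic curve,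
`k = 2`): `p ≠ 2`, good at `p` (crystalline; short since `k = 2 ≤ p`), `a_p = 0` (then `ρ̄|G_p` is
irreducible), `E[p]` irreducible (kept for comparability with the §5 binder; implied), Kato's (12.5.2)
`Kato2004.ImageContainsSL2 W p`, a prime `ℓ ≠ p` of NON-SPLIT multiplicative reduction with `E[p]` ramified
at `ℓ` (`p ∤ ord_ℓ Δ_min`; = (iii) in FW's convention `ρ_f = T_pE(−1)`, sub-character the unramified `μ`,
`μ ≠ 1`) ⇒ `KobayashiMainConjecture W p ε` for every sign `ε`. NEVER cite this `Prop` as a theorem; it is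
the conjunction «FW Thm 4.51 (PRE, §4.6 only — no universal-deformation argument) ∘ Kobayashi Thm 7.4
(PUB)». It is implied by `FouquetWan2021_thm51_via_kobayashi74_OPEN` (`thm451_OPEN_of_thm51_OPEN`).
[claim: FouquetWan2021, status: under-review] [cite: Kobayashi2003, Thm. 7.4 (p. 13)]
[cite: Kato2004Asterisque, (12.5.2) in Thm. 12.5 (4) (p. 222)] -/
def FouquetWan2021_thm451_via_kobayashi74_OPEN : Prop :=
  ∀ (W : WeierstrassCurve ℚ) [W.IsElliptic] [W.IsGloballyMinimal] (p : ℕ) [Fact p.Prime],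
    p ≠ 2 → W.HasGoodReductionAtPrime p → W.frobeniusTrace p = 0 → Irr W p →
    Kato2004.ImageContainsSL2 W p →
    (∃ (ℓ : ℕ) (_ : Fact ℓ.Prime), ℓ ≠ p ∧ W.HasMultiplicativeReductionAtPrime ℓ ∧
        ¬ W.HasSplitMultiplicativeReductionAtPrime ℓ ∧ ¬ p ∣ padicValInt ℓ W.minimalDiscriminantInt) →
    ∀ ε : ℤˣ, KobayashiMainConjecture W p ε

/-- **The §5 binder implies the §4.6 binder** (Thm 5.1's transcription has the same hypotheses minus Kato's
(12.5.2)): so conditional results modulo `FouquetWan2021_thm451_via_kobayashi74_OPEN` are the stronger ones.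
Pure logic. [claim: FouquetWan2021, status: under-review] -/
theorem thm451_OPEN_of_thm51_OPEN (h : FouquetWan2021_thm51_via_kobayashi74_OPEN) :
    FouquetWan2021_thm451_via_kobayashi74_OPEN :=
  fun W _ _ p _ hp hgood hap hirr _himg hloc ε => h W p hp hgood hap hirr hloc ε

variable (W : WeierstrassCurve ℚ) [W.IsElliptic] [W.IsGloballyMinimal] (p : ℕ) [Fact p.Prime]

/-- **X7 ∩ {surj(p)} on the Fouquet–Wan locus, EVERY odd `p` (including `p = 3`): the signed main conjecture
for both signs MODULO the §4.6 binder** — Kato's (12.5.2) is DISCHARGED by the tree theorem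
`ClassX7.imageContainsSL2_of_surj` (Serre at `p ≥ 5`, Wuthrich 2014 Lemma 20 at a good supersingular `3`),
`E[p]` irreducible by `ClassX7.irr` (Serre Prop 12). CONDITIONAL; closes nothing.
[claim: FouquetWan2021, status: under-review] [cite: Kobayashi2003, Thm. 7.4 (p. 13)]
[cite: Wuthrich2014, Lemma 20 (p. 399)] [cite: Kato2004Asterisque, (12.5.2) in Thm. 12.5 (4) (p. 222)] -/
theorem X7.kobayashiMainConjecture_of_thm451_OPEN_of_surj (hFW : FouquetWan2021_thm451_via_kobayashi74_OPEN)
    (hp : p ≠ 2) (hX : ClassX7 W p) (hap : W.frobeniusTrace p = 0) (hs : Surj W p)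
    (hloc : ∃ (ℓ : ℕ) (_ : Fact ℓ.Prime), ℓ ≠ p ∧ W.HasMultiplicativeReductionAtPrime ℓ ∧
        ¬ W.HasSplitMultiplicativeReductionAtPrime ℓ ∧ ¬ p ∣ padicValInt ℓ W.minimalDiscriminantInt)
    (ε : ℤˣ) : KobayashiMainConjecture W p ε :=
  hFW W p hp hX.1.1 hap (ClassX7.irr W p hp hX) (ClassX7.imageContainsSL2_of_surj W p hp hX hs) hloc ε

/-- **`stub_fwLocus` of crux `KobayashiLowerHalfLargeImage`, EITHER rank, EVERY odd `p`, closed MODULO the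
§4.6 binder** (the weaker Fouquet–Wan claim): at an X7 pair with `a_p = 0`, `ρ̄_{E,p}` onto and a non-split
multiplicative `ℓ ≠ p` with `p ∤ ord_ℓ(Δ_min)`, the Eisenstein half of Kobayashi's main conjecture holds for
some (indeed every) sign. The surjectivity binder is USED (it gives Kato's (12.5.2)). CONDITIONAL; closes
nothing. [claim: FouquetWan2021, status: under-review] [cite: Kobayashi2003, Thm. 7.4 (p. 13) and Conjecture (p. 2)]
[cite: Wuthrich2014, Lemma 20 (p. 399)] -/
theorem X7.kobayashiLowerDivisibility_of_thm451_OPEN (hFW : FouquetWan2021_thm451_via_kobayashi74_OPEN)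
    (hp : p ≠ 2) (hX : ClassX7 W p) (hap : W.frobeniusTrace p = 0) (hs : Surj W p)
    (hloc : ∃ (ℓ : ℕ) (_ : Fact ℓ.Prime), ℓ ≠ p ∧ W.HasMultiplicativeReductionAtPrime ℓ ∧
        ¬ W.HasSplitMultiplicativeReductionAtPrime ℓ ∧ ¬ p ∣ padicValInt ℓ W.minimalDiscriminantInt) :
    ∃ ε : ℤˣ, KobayashiLowerDivisibility W p ε :=
  ⟨1, kobayashiLowerDivisibility_of_mainConjecture
    (X7.kobayashiMainConjecture_of_thm451_OPEN_of_surj W p hFW hp hX hap hs hloc 1)⟩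

/-- **X7 ∩ {surj(p)} ∩ {r_an = 1} on the Fouquet–Wan locus: `BSD(E,p)` MODULO the §4.6 binder**, via the
tree's rank-one ± road (Burungale–Kobayashi–Ota 2024 Cor A.5 `hA5`, modularity `hmod`, GZK `hGZK`) — the
bulk of the cell window (917 of the 1 004 locus pairs). CONDITIONAL; closes nothing.
[claim: FouquetWan2021, status: under-review] [cite: BurungaleKobayashiOta2023, App. A Cor. A.5]
[cite: Kobayashi2003, Thm. 7.4 (p. 13)] [cite: Miller2011LMS, §1 and Def. 1.1] -/
theorem X7.bsdp_of_thm451_OPEN_of_corA5_of_analyticRank_eq_one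
    (hFW : FouquetWan2021_thm451_via_kobayashi74_OPEN)
    (hA5 : BurungaleKobayashiOta2024.corA5_pPart_of_signedCharIdeal_eq) (hmod : hasEntireLFunction_rat)
    (hGZK : rank_eq_analyticRank_of_analyticRank_le_one)
    (hp : p ≠ 2) (hX : ClassX7 W p) (hap : W.frobeniusTrace p = 0) (hs : Surj W p)
    (hloc : ∃ (ℓ : ℕ) (_ : Fact ℓ.Prime), ℓ ≠ p ∧ W.HasMultiplicativeReductionAtPrime ℓ ∧
        ¬ W.HasSplitMultiplicativeReductionAtPrime ℓ ∧ ¬ p ∣ padicValInt ℓ W.minimalDiscriminantInt)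
    (h1 : W.analyticRank = 1) : BSDp W p :=
  _root_.Summit.BirchSwinnertonDyer.Rank1Residual.Supersingular.bsdp_of_kobayashiMainConjecture_of_corA5_of_analyticRank_eq_one
    W p hA5 hmod hGZK hp hX.1.1 hap h1 1
    (X7.kobayashiMainConjecture_of_thm451_OPEN_of_surj W p hFW hp hX hap hs hloc 1)

/-- **X7 ∩ {surj(p)} ∩ {r_an = 0} on the Fouquet–Wan locus: `BSD(E,p)` MODULO the §4.6 binder**, via the
tree's rank-zero ± road (Kobayashi Thm 1.2 `h12`, B. D. Kim Cor 3.15 `hKim`, Pollack `hPollack`, modularity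
`hmod`/`hmod'`, GZK `hGZK`). CONDITIONAL; closes nothing. [claim: FouquetWan2021, status: under-review]
[cite: Kobayashi2003, Thm. 1.2 and Thm. 7.4] [cite: BDKim2013, Cor. 3.15 (p. 199)] [cite: Miller2011LMS, §1 and Def. 1.1] -/
theorem X7.bsdp_of_thm451_OPEN_of_analyticRank_eq_zero
    (hFW : FouquetWan2021_thm451_via_kobayashi74_OPEN)
    (h12 : Kobayashi2003.thm12_signedSelmerDual_finite_torsion)
    (hKim : BDKim2013.cor315_signedCharValue_rankZero)
    (hPollack : ∀ {N : ℕ} [NeZero N] {f : CuspForm (Gamma0 N) 2},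
      pollack_exists_plusMinusPAdicLFunction (W := W) (f := f) (p := p))
    (hmod : nonempty_modularParametrizationData) (hmod' : hasEntireLFunction_rat)
    (hGZK : rank_eq_analyticRank_of_analyticRank_le_one)
    (hp : p ≠ 2) (hX : ClassX7 W p) (hap : W.frobeniusTrace p = 0) (hs : Surj W p)
    (hloc : ∃ (ℓ : ℕ) (_ : Fact ℓ.Prime), ℓ ≠ p ∧ W.HasMultiplicativeReductionAtPrime ℓ ∧
        ¬ W.HasSplitMultiplicativeReductionAtPrime ℓ ∧ ¬ p ∣ padicValInt ℓ W.minimalDiscriminantInt)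
    (h0 : W.analyticRank = 0) : BSDp W p :=
  _root_.Summit.BirchSwinnertonDyer.Rank1Residual.Supersingular.bsdp_of_kobayashiMainConjecture_of_analyticRank_eq_zero
    W p h12 hKim hPollack hmod hmod' hGZK hp hX.1.1 hap (ClassX7.irr W p hp hX) h0
    (X7.kobayashiMainConjecture_of_thm451_OPEN_of_surj W p hFW hp hX hap hs hloc 1)

end Summit.BirchSwinnertonDyer.Rank1Residual.Supersingular

end
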